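import Summits.RiemannHypothesis.RiemannHypothesis.Theorems.SpectralTraceWindowStepQuietSynthesis
import Summits.RiemannHypothesis.RiemannHypothesis.Theorems.SpectralTraceWindowStepQuietCalibration
import HarnessLib

/-!
# Floor–feedback quantisation: the STRUCTURE of a quiet rung (what `QuietRung A` hands to an attacker)

Route `RiemannHypothesis/SpectralTrace`, crux `WindowStep` (stmt-RiemannHypothesis-14659), line `floor-feedback`, held stub
`∀ n ≥ 2, QuietRung (log n)` (lead session 1).  The synthesis theorems (`SpectralTraceWindowStepQuietSynthesis.lean`) give
`QuietRung A → Trace(A)` with an ANONYMOUS family.  For the obstruction hunt on `QuietRung (log 2)` one wants the family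
NAMED, together with the a-priori structure the floor–feedback parametrisation forces on it.  This file provides exactly that:

* `crossingFamily_hasSum` — exact synthesis with the EXPLICIT witness: under the hypotheses of K2⁺ the first crossings
  `γ_j := sInf {T | j ≤ Φ T + h T}` (`j ∈ ℤ`) satisfy `HasSum_j ĝ(1/2 + iγ_j) = W(g)` for every window test (same proof as
  the landed `stub_traceAssembly`, p98459, with the witness kept);
* `quietRung_structure` — from `QuietRung A` (`A > 0`) one gets `h`, an admissible `k` and the crossing family
  `γ : ℤ → ℝ` of `G = Φ_A + h` with: (i) exactness at level `A` (the `HasSum` above); (ii) `γ` strictly increasing and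
  `G (γ j) = j`; (iii) counting law `j ≤ ⌊G T⌋ ↔ γ j ≤ T` (so `⌊G⌋` IS the counting function of the family, monotone on
  `ℝ`); (iv) BOUNDED DISCREPANCY `|⌊G T⌋ − Φ_A T| ≤ ‖k‖₁ + 1` (co-lead c1's `abs_floor_sub_le_of_isFloorFeedback`, p97431);
  (v) `|h| ≤ ‖k‖₁`; (vi) the Bernstein floor `A ≤ ‖k′‖₁` (c1's `le_slopeBudget_of_isFeedbackKernel`).
  In words: a quiet rung at level `A` is an exact POSITIVE UNIT-MULTIPLICITY family whose counting function stays within a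
  constant of the explicit smooth count `Φ_A` — the precise target class for a `¬ QuietRung (log 2)` theorem
  (`quietRung_two_imp_windowTraceArch` already places it inside the tier-deciding crux `WindowTraceArch`).

All statements are unconditional (the quiet hypothesis sits in the type); 0 sorry.
-/

set_option linter.dupNamespace false

noncomputable section

open Complex Filter Set MeasureTheory
open scoped Real Topology BigOperators FourierTransform SchwartzMap

namespace Summit.RiemannHypothesis.RiemannHypothesis.Theorems.SpectralTraceWindowStep

open Literature.NumberTheory.LFunctions
open Summit.RiemannHypothesis.RiemannHypothesis.Theses.SpectralTrace
open Summit.RiemannHypothesis.RiemannHypothesis.Theorems.FloorFeedback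
open Summit.RiemannHypothesis.RiemannHypothesis.Theorems.WindowTraceArch.Negative

/-- **Exact synthesis with the explicit witness.** Under the hypotheses of K2⁺ (window density `ρ` with primitive `Φ`,
`O(log)`; kernel with `𝓕k ≡ 1` on the band; continuous solution `h` of the feedback equation; `⌊Φ + h⌋` monotone;
`Φ + h → ±∞`), the first crossings `γ_j = sInf {T | j ≤ Φ T + h T}` reproduce `W` on every Weil test supported in
`[-A, A]`.  (The proof of the landed `stub_traceAssembly`, p98459, with the witness kept.) [folklore] -/
theorem crossingFamily_hasSum {A : ℝ} {Φ ρ h : ℝ → ℝ} {k : 𝓢(ℝ, ℝ)}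
    (hwin : IsWindowDensity A ρ) (hΦ : ∀ T : ℝ, HasDerivAt Φ (ρ T) T)
    (hρlog : ∃ C : ℝ, ∀ T : ℝ, |ρ T| ≤ C * Real.log (2 + |T|)) (hband : IsFeedbackKernel A k)
    (hhc : Continuous h) (hfeed : ∀ T : ℝ, h T = ∫ s : ℝ, k (T - s) * Int.fract (Φ s + h s))
    (hmono : Monotone fun T : ℝ => ⌊Φ T + h T⌋) (htop : Tendsto (fun T : ℝ => Φ T + h T) atTop atTop)
    (hbot : Tendsto (fun T : ℝ => Φ T + h T) atBot atBot) {g : ℝ → ℂ} (hg : IsWeilTest g)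
    (hsupp : tsupport g ⊆ Icc (-A) A) :
    HasSum (fun j : ℤ => weilMellin g (1 / 2 + ((sInf {T : ℝ | (j : ℝ) ≤ Φ T + h T} : ℝ) : ℂ) * I))
      (weilFunctional g) := by
  obtain ⟨LΦ, hLΦ⟩ := stub_traceAssembly_growth hΦ hρlog
  have hK : ∀ T : ℝ, |h T| ≤ ∫ s : ℝ, |k s| := stub_traceAssembly_feedback_bound k hfeed
  have hK0 : 0 ≤ ∫ s : ℝ, |k s| := integral_nonneg fun s => abs_nonneg _
  have hK' : ∀ T : ℝ, |h T| ≤ (∫ s : ℝ, |k s|) * (1 + T ^ 2) := fun T =>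
    (hK T).trans (le_mul_of_one_le_right hK0 (by nlinarith [sq_nonneg T]))
  have hΦc : Continuous Φ := continuous_iff_continuousAt.2 fun T => (hΦ T).continuousAt
  have hg₁ : IsWeilTest fun t : ℝ => (t : ℂ) * g t := isWeilTest_mul_id hg
  have hsupp₁ : tsupport (fun t : ℝ => (t : ℂ) * g t) ⊆ Icc (-A) A :=
    tsupport_mul_subset_right.trans hsupp
  obtain ⟨C, hFd, hF'd⟩ := stub_traceAssembly_decay_pair hg
  have hF'c : Continuous fun T : ℝ =>
      I * weilMellin (fun t : ℝ => (t : ℂ) * g t) (1 / 2 + (T : ℂ) * I) :=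
    continuous_const.mul ((continuous_weilMellin hg₁.1.continuous hg₁.2).comp (by fun_prop))
  have hGg : ∀ T : ℝ, |Φ T + h T| ≤ (LΦ + ∫ s : ℝ, |k s|) * (1 + T ^ 2) := fun T => by
    have := abs_add_le (Φ T) (h T)
    nlinarith [hLΦ T, hK' T]
  -- K2b (landed): the crossing sum equals `-∫ F' ⌊G⌋`
  have hsum : HasSum
      (fun j : ℤ => weilMellin g (1 / 2 + ((sInf {T : ℝ | (j : ℝ) ≤ Φ T + h T} : ℝ) : ℂ) * I))
      (-∫ T : ℝ, I * weilMellin (fun t : ℝ => (t : ℂ) * g t) (1 / 2 + (T : ℂ) * I) *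
        ((⌊Φ T + h T⌋ : ℝ) : ℂ)) :=
    stub_crossingSum (fun T => Φ T + h T) (fun T => weilMellin g (1 / 2 + (T : ℂ) * I))
      (fun T => I * weilMellin (fun t : ℝ => (t : ℂ) * g t) (1 / 2 + (T : ℂ) * I)) C
      (LΦ + ∫ s : ℝ, |k s|) (hΦc.add hhc) hmono htop hbot hGg (hasDerivAt_weilMellin_line hg) hF'c
      hFd hF'd
  -- K2a (landed): the feedback is invisible to the window test `t ↦ t g(t)`
  have hbb : ∀ s : ℝ, |Int.fract (Φ s + h s)| ≤ 1 := fun s => by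
    rw [abs_of_nonneg (Int.fract_nonneg _)]
    exact (Int.fract_lt_one _).le
  have hex : ∫ T : ℝ, weilMellin (fun t : ℝ => (t : ℂ) * g t) (1 / 2 + (T : ℂ) * I) *
        ((∫ s : ℝ, k (T - s) * Int.fract (Φ s + h s) : ℝ) : ℂ) =
      ∫ T : ℝ, weilMellin (fun t : ℝ => (t : ℂ) * g t) (1 / 2 + (T : ℂ) * I) *
        ((Int.fract (Φ T + h T) : ℝ) : ℂ) :=
    stub_bandExclusion A (fun t : ℝ => (t : ℂ) * g t) k (fun T => Int.fract (Φ T + h T)) 1 hg₁ hsupp₁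
      hband (hΦc.add hhc).measurable.fract hbb
  have hex' : ∫ T : ℝ, weilMellin (fun t : ℝ => (t : ℂ) * g t) (1 / 2 + (T : ℂ) * I) *
        ((h T : ℝ) : ℂ) =
      ∫ T : ℝ, weilMellin (fun t : ℝ => (t : ℂ) * g t) (1 / 2 + (T : ℂ) * I) *
        ((Int.fract (Φ T + h T) : ℝ) : ℂ) := by
    rw [← hex]
    refine integral_congr_ae (Eventually.of_forall fun T => ?_)
    show _ * ((h T : ℝ) : ℂ) = _
    rw [hfeed T]
  rw [stub_traceAssembly_value hg (hwin g hg hsupp) hΦ hLΦ hhc hK' hex' hFd hF'd] at hsum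
  exact hsum

/-- **STRUCTURE OF A QUIET RUNG.** From `QuietRung A` with `A > 0`: a feedback `h`, an admissible kernel `k`, and the
crossing family `γ j = sInf {T | j ≤ Φ_A T + h T}` of `G = Φ_A + h` such that (i) `γ` is an EXACT family at level `A`
(`HasSum_j ĝ(1/2+iγ_j) = W(g)` on the window), (ii) `γ` is strictly increasing with `G (γ j) = j`, (iii) `⌊G⌋` is its
counting function (`j ≤ ⌊G T⌋ ↔ γ j ≤ T`, and `⌊G⌋` is monotone on all of `ℝ`), (iv) BOUNDED DISCREPANCY
`|⌊G T⌋ − Φ_A T| ≤ ‖k‖₁ + 1`, (v) `|h| ≤ ‖k‖₁`, (vi) the Bernstein floor `A ≤ ‖k′‖₁`. [folklore] -/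
theorem quietRung_structure {A : ℝ} (hA : 0 < A) (hq : QuietRung A) :
    ∃ (h : ℝ → ℝ) (k : 𝓢(ℝ, ℝ)), IsFeedbackKernel A k ∧ IsFloorFeedback (modelCount A) h k ∧
      (∀ g : ℝ → ℂ, IsWeilTest g → tsupport g ⊆ Icc (-A) A →
        HasSum (fun j : ℤ => weilMellin g
          (1 / 2 + ((sInf {T : ℝ | (j : ℝ) ≤ modelCount A T + h T} : ℝ) : ℂ) * I)) (weilFunctional g)) ∧
      StrictMono (fun j : ℤ => sInf {T : ℝ | (j : ℝ) ≤ modelCount A T + h T}) ∧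
      (∀ j : ℤ, modelCount A (sInf {T : ℝ | (j : ℝ) ≤ modelCount A T + h T}) +
        h (sInf {T : ℝ | (j : ℝ) ≤ modelCount A T + h T}) = j) ∧
      (∀ (j : ℤ) (T : ℝ), j ≤ ⌊modelCount A T + h T⌋ ↔ sInf {T : ℝ | (j : ℝ) ≤ modelCount A T + h T} ≤ T) ∧
      Monotone (fun T : ℝ => ⌊modelCount A T + h T⌋) ∧
      (∀ T : ℝ, |((⌊modelCount A T + h T⌋ : ℤ) : ℝ) - modelCount A T| ≤ (∫ s, |k s|) + 1) ∧
      (∀ T : ℝ, |h T| ≤ ∫ s, |k s|) ∧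
      A ≤ slopeBudget k := by
  obtain ⟨h, k, hk, hfb, hmonoI⟩ := hq
  obtain ⟨hcont, hderiv, hlog, h1, hfloor⟩ := stub_modelRegular A
  have hwd : IsWindowDensity A (modelDensity A) := stub_modelDensity A hA
  obtain ⟨-, hup, hdown, htop, hbot⟩ :=
    stub_slopeAbove (modelCount A) (modelDensity A) h k (floorHeight A) (floorConst A) h1 hderiv hfloor hfb.1
      hfb.2
  have hmono : Monotone fun T : ℝ => ⌊modelCount A T + h T⌋ :=
    quietCalibration_monotone_floor (G := fun T => modelCount A T + h T) (handover_pos _ _ _).le hmonoI hup hdown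
  have hGc : Continuous fun T : ℝ => modelCount A T + h T :=
    (continuous_iff_continuousAt.2 fun T => (hderiv T).continuousAt).add hfb.1
  have hlevel : ∀ j : ℤ, modelCount A (sInf {T : ℝ | (j : ℝ) ≤ modelCount A T + h T}) +
      h (sInf {T : ℝ | (j : ℝ) ≤ modelCount A T + h T}) = j := fun j =>
    stub_crossingSum_level (G := fun T => modelCount A T + h T) hGc htop hbot (j : ℝ)
  have hiff : ∀ (j : ℤ) (T : ℝ), j ≤ ⌊modelCount A T + h T⌋ ↔
      sInf {T : ℝ | (j : ℝ) ≤ modelCount A T + h T} ≤ T := fun j T =>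
    stub_crossingSum_iff (G := fun T => modelCount A T + h T) hGc hmono htop hbot j T
  refine ⟨h, k, hk, hfb, fun g hg hsupp => ?_, ?_, hlevel, hiff, hmono,
    fun T => abs_floor_sub_le_of_isFloorFeedback hfb T, fun T => abs_le_of_isFloorFeedback hfb T,
    le_slopeBudget_of_isFeedbackKernel hk⟩
  · exact crossingFamily_hasSum hwd hderiv hlog hk hfb.1 hfb.2 hmono htop hbot hg hsupp
  · -- strict monotonicity of the crossing family: `γ_i ≤ γ_j` from the counting law, `γ_i ≠ γ_j` from the levels
    intro i j hij
    show sInf {T : ℝ | (i : ℝ) ≤ modelCount A T + h T} < sInf {T : ℝ | (j : ℝ) ≤ modelCount A T + h T}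
    have hle : sInf {T : ℝ | (i : ℝ) ≤ modelCount A T + h T} ≤ sInf {T : ℝ | (j : ℝ) ≤ modelCount A T + h T} := by
      refine (hiff i _).1 ?_
      rw [hlevel j, Int.floor_intCast]
      exact hij.le
    refine lt_of_le_of_ne hle fun heq => ?_
    have hi := hlevel i
    rw [heq, hlevel j] at hi
    have hji : j = i := by exact_mod_cast hi
    exact absurd hji (ne_of_gt hij)

/-- Registered lead helper `quietRung_boundedDiscrepancyFamily` (attack surface of the held stub, ∀-form): a quiet rung at
level `A > 0` yields a STRICTLY INCREASING exact unit-multiplicity family `γ : ℤ → ℝ` at level `A` and a constant `B` with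
`|#{atoms ≤ T, counted by ⌊Φ_A + h⌋} − Φ_A(T)| ≤ B`, i.e. whose counting function is `Φ_A + O(1)`. [folklore] -/
theorem quietRung_boundedDiscrepancyFamily : ∀ A : ℝ, 0 < A → QuietRung A →
    ∃ (γ : ℤ → ℝ) (N : ℝ → ℤ) (B : ℝ), StrictMono γ ∧
      (∀ g : ℝ → ℂ, IsWeilTest g → tsupport g ⊆ Icc (-A) A →
        HasSum (fun j : ℤ => weilMellin g (1 / 2 + ((γ j : ℝ) : ℂ) * I)) (weilFunctional g)) ∧
      (∀ (j : ℤ) (T : ℝ), j ≤ N T ↔ γ j ≤ T) ∧ (∀ T : ℝ, |((N T : ℤ) : ℝ) - modelCount A T| ≤ B) := by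
  intro A hA hq
  obtain ⟨h, k, -, -, hsum, hsm, -, hiff, -, hdisc, -, -⟩ := quietRung_structure hA hq
  exact ⟨fun j => sInf {T : ℝ | (j : ℝ) ≤ modelCount A T + h T}, fun T => ⌊modelCount A T + h T⌋,
    (∫ s, |k s|) + 1, hsm, hsum, hiff, hdisc⟩

end Summit.RiemannHypothesis.RiemannHypothesis.Theorems.SpectralTraceWindowStep

end
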